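import Literature.AnabelianGeometry.SemiGraphs.WitnessIwahoriApprox
import Literature.AnabelianGeometry.SemiGraphs.TemperedVerticialInjective
import HarnessLib

/-!
# The estranged loop `𝒢₁`, part 3: Galois-countability and the assembled hypothesis bundles

Witness file of the abc-iut cell (layer L3, row WIT-1b, part 3; companion of `WitnessIwahoriLoop`,
`WitnessIwahoriApprox`). Source of the bundles: S. Mochizuki, *Semi-graphs of anabelioids*, Publ. RIMS
**42** (2006), Prop. 3.6 p. 38, Thm. 3.7 p. 40, Cor. 3.9 p. 42, with the Galois-countability erratum of
[IUTchI] Rmk. 2.5.3 (i) (T2) as bundled in the tree's `Prop36Hypotheses` / `Thm37Hypotheses` /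
`Cor39Hypotheses`.

* `loopGraph_isGaloisCountable` — the trivialising coverings `(approx p n).trivCov` of the level-`n`
  approximators (the tree's generic construction of the proof of Prop. 2.5 (i),
  `Approximator.trivCov`) form a countable family of finite coverings with nonempty fibres splitting
  every finite covering (their point stabilisers are the level-`n` kernels).
* `loopGraph_prop36Hypotheses`, `loopGraph_thm37Hypotheses`, `loopGraph_cor39Hypotheses` — **every
  clause of the three bundles holds for `𝒢₁`, an object WITH AN (estranged) EDGE**; the ∃-certificates
  `exists_cor39Hypotheses_with_edge`, and the PAIR-level datum the statement of Cor. 3.9 quantifies over: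
  the identity morphism `loopGraphId` is locally open (`loopGraphId_isLocallyOpen`), so the hypothesis
  list «`𝒢`, `ℋ` with `Cor39Hypotheses`, `F : 𝒢 → ℋ` locally open» is jointly satisfiable with an edge
  present (`exists_cor39_pair_with_edge`).

* §4 `exists_distinct_locallyOpen_homs_same_base` — the Rmk. 2.4.2 conjugation indeterminacy is
  non-trivial on `𝒢₁` (the O-Cor39-1 carrier asked for by the lead): `loopGraphConj (1,0) ≠ loopGraphId`,
  same base, same edge homomorphisms, both locally open.

Honest limits: a consistency witness for the typed hypothesis bundles; it is not the semi-graph of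
anabelioids of any curve. No side is taken on [IUTchIII] Cor. 3.12.
[cite: MochizukiSemiAnbd2006, Cor 3.9 p.42]
-/

noncomputable section

open Topology CategoryTheory

namespace Literature.AnabelianGeometry.SemiGraphs

namespace IwahoriWitness

open ProfiniteSemiGraph

variable (p : ℕ) [Fact p.Prime]

/-! ## 1. Galois-countability -/

/-- The trivialising covering of the level-`n` approximator: a finite object of `B^cov(𝒢₁)` with
nonempty fibres. [cite: MochizukiSemiAnbd2006, Prop 2.5 p.27] -/
def levelCov (n : ℕ) : CovObj (loopGraph p) :=
  (approx p n).trivCov (M := Nat.card (IwMod p n)) Nat.card_pos fun _ => dvd_rfl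

/-- A point of the `v`-constituent of `levelCov n` fixed by `g` forces `g` into the level-`n` kernel.
[cite: MochizukiSemiAnbd2006, Prop 2.5 p.27] -/
theorem toMod_eq_one_of_fix_V (n : ℕ) (v : (loopGraph p).graph.Vertex)
    (x : ((levelCov p n).SV v).obj.V) (g : Iw p) (h : ((levelCov p n).SV v).obj.ρ g x = x) :
    Iw.toMod n g = 1 := by
  have h' : ((approx p n).objV (Nat.card (IwMod p n)) v).obj.ρ g x = x := h
  rw [Approximator.objV_ρ] at h'
  exact mul_eq_right.1 (Prod.ext_iff.1 h').1

/-- Same over the edge. [cite: MochizukiSemiAnbd2006, Prop 2.5 p.27] -/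
theorem toMod_eq_one_of_fix_E (n : ℕ) (e : (loopGraph p).graph.Edge)
    (x : ((levelCov p n).SE e).obj.V) (g : IwU p) (h : ((levelCov p n).SE e).obj.ρ g x = x) :
    IwU.toMod n g = 1 := by
  have h' : ((approx p n).objE (Nat.card (IwMod p n)) e).obj.ρ g x = x := h
  rw [Approximator.objE_ρ] at h'
  exact mul_eq_right.1 (Prod.ext_iff.1 h').1

/-- **`𝒢₁` is Galois-countable** ([IUTchI] Rmk. 2.5.3 (i) (T2)). [cite: Mochizuki2012, IUTchI Rmk 2.5.3 (i) (T2), p. 52] -/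
theorem loopGraph_isGaloisCountable : (loopGraph p).IsGaloisCountable := by
  refine ⟨loopGraph_isCountable p, levelCov p, fun n => ⟨?_, ?_⟩, ?_⟩
  · exact (approx p n).trivCov_isFinite _ _
  · exact (approx p n).trivCov_hasNonemptyFibres _ _
  · intro H hH
    haveI : Finite (H.SV PUnit.unit).obj.V := hH.finite_V PUnit.unit
    haveI : Finite (H.SE ⟨0⟩).obj.V := hH.finite_E ⟨0⟩
    obtain ⟨n₁, h₁⟩ := exists_level_acts_trivially_V p (H.SV PUnit.unit)
    obtain ⟨n₂, h₂⟩ := exists_level_acts_trivially_E p (H.SE ⟨0⟩)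
    refine ⟨max n₁ n₂, ?_, ?_⟩
    · rintro ⟨⟩ x g hgx s
      exact h₁ g (Iw.toMod_eq_one_mono (le_max_left _ _) g (toMod_eq_one_of_fix_V p _ _ x g hgx)) s
    · rintro ⟨e⟩ x g hgx s
      obtain rfl : e = 0 := Subsingleton.elim _ _
      exact h₂ g (IwU.toMod_eq_one_mono (le_max_right _ _) g (toMod_eq_one_of_fix_E p _ _ x g hgx)) s

/-! ## 2. The bundles -/

/-- **`𝒢₁` satisfies the hypotheses of Prop. 3.6** — with an edge present.
[cite: MochizukiSemiAnbd2006, Prop 3.6 p.38] -/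
theorem loopGraph_prop36Hypotheses : (loopGraph p).Prop36Hypotheses where
  isConnected := loopGraph_isConnected p
  isCountable := loopGraph_isCountable p
  isGaloisCountable := loopGraph_isGaloisCountable p
  hasVertex := loopGraph_hasVertex p
  isOfInjectiveType := loopGraph_isOfInjectiveType p
  isQuasiCoherent := loopGraph_isQuasiCoherent p
  isTotallyElevated := loopGraph_isTotallyElevated p
  isTotallyAloof := loopGraph_isTotallyAloof p
  isVerticiallySlim := loopGraph_isVerticiallySlim p

/-- **`𝒢₁` satisfies the hypotheses of Thm. 3.7** (totally estranged). [cite: MochizukiSemiAnbd2006, Thm 3.7 p.40] -/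
theorem loopGraph_thm37Hypotheses : (loopGraph p).Thm37Hypotheses where
  toProp36Hypotheses := loopGraph_prop36Hypotheses p
  isTotallyEstranged := loopGraph_isTotallyEstranged p

/-- **`𝒢₁` satisfies the hypotheses of Cor. 3.9** (a totally estranged GRAPH of anabelioids).
[cite: MochizukiSemiAnbd2006, Cor 3.9 p.42] -/
theorem loopGraph_cor39Hypotheses : Cor39Hypotheses (loopGraph p) where
  toProp36Hypotheses := loopGraph_prop36Hypotheses p
  isTotallyEstranged := loopGraph_isTotallyEstranged p
  isGraph := loopGraph_isGraph p

/-- Non-vacuity WITH AN EDGE: some `𝒢` with an edge satisfies all three bundles.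
[cite: MochizukiSemiAnbd2006, Cor 3.9 p.42] -/
theorem exists_cor39Hypotheses_with_edge :
    ∃ 𝒢 : ProfiniteSemiGraph.{0}, Nonempty 𝒢.graph.Edge ∧ 𝒢.Prop36Hypotheses ∧ 𝒢.Thm37Hypotheses ∧
      Cor39Hypotheses 𝒢 :=
  ⟨loopGraph 2, ⟨⟨0⟩⟩, loopGraph_prop36Hypotheses 2, loopGraph_thm37Hypotheses 2,
    loopGraph_cor39Hypotheses 2⟩

/-! ## 3. The pair-level datum of Cor. 3.9: a locally open morphism -/

/-- The identity morphism of `𝒢₁` in the local presentation (vertex/edge homomorphisms the identities,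
conjugators `g = 1`). [cite: MochizukiSemiAnbd2006, Rmk 2.4.2 p.26] -/
def loopGraphId : ProfiniteSemiGraph.Hom (loopGraph p) (loopGraph p) where
  base := SemiGraph.Hom.id _
  hV _ := ContinuousMonoidHom.id _
  hE _ := ContinuousMonoidHom.id _
  comm b v h := ⟨1, fun x => by rw [one_mul, inv_one, mul_one]; rfl⟩

/-- The identity morphism is locally open. [cite: MochizukiSemiAnbd2006, Def 2.2(ii) p.24] -/
theorem loopGraphId_isLocallyOpen : (loopGraphId p).IsLocallyOpen := by
  constructor
  · intro v
    have : ((loopGraphId p).hV v).toMonoidHom.range = ⊤ := MonoidHom.range_eq_top.2 fun x => ⟨x, rfl⟩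
    rw [this]; exact isOpen_univ
  · intro e
    have : ((loopGraphId p).hE e).toMonoidHom.range = ⊤ := MonoidHom.range_eq_top.2 fun x => ⟨x, rfl⟩
    rw [this]; exact isOpen_univ

/-- **The hypothesis list of Cor. 3.9 is jointly satisfiable WITH AN EDGE**: graphs of anabelioids
`𝒢`, `ℋ` satisfying `Cor39Hypotheses`, `𝒢` with an edge, and a locally open morphism `F : 𝒢 → ℋ`.
[cite: MochizukiSemiAnbd2006, Cor 3.9 p.42] -/
theorem exists_cor39_pair_with_edge :
    ∃ (𝒢 ℋ : ProfiniteSemiGraph.{0}) (F : ProfiniteSemiGraph.Hom 𝒢 ℋ),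
      Nonempty 𝒢.graph.Edge ∧ Cor39Hypotheses 𝒢 ∧ Cor39Hypotheses ℋ ∧ F.IsLocallyOpen :=
  ⟨loopGraph 2, loopGraph 2, loopGraphId 2, ⟨⟨0⟩⟩, loopGraph_cor39Hypotheses 2,
    loopGraph_cor39Hypotheses 2, loopGraphId_isLocallyOpen 2⟩

/-! ## 4. The Rmk. 2.4.2 indeterminacy is non-trivial on `𝒢₁` (carrier for O-Cor39-1) -/

/-- Conjugation by `g ∈ P` as a continuous automorphism of the vertex group.
[cite: MochizukiSemiAnbd2006, Rmk 2.4.2 p.26] -/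
def conjHom (g : Iw p) : Iw p →ₜ* Iw p where
  toMonoidHom := (MulAut.conj g).toMonoidHom
  continuous_toFun := IsTopologicalGroup.continuous_conj g

/-- `conjHom g x = g x g⁻¹`. [cite: MochizukiSemiAnbd2006, Rmk 2.4.2 p.26] -/
@[simp] theorem conjHom_apply (g x : Iw p) : conjHom p g x = g * x * g⁻¹ := rfl

/-- The morphism `𝒢₁ → 𝒢₁` with identity base, vertex homomorphism CONJUGATION BY `g`, identity on the
edge group — a legitimate morphism of semi-graphs of anabelioids (the branch compatibility of Rmk. 2.4.2
holds with conjugator `g`). [cite: MochizukiSemiAnbd2006, Rmk 2.4.2 p.26] -/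
def loopGraphConj (g : Iw p) : ProfiniteSemiGraph.Hom (loopGraph p) (loopGraph p) where
  base := SemiGraph.Hom.id _
  hV _ := conjHom p g
  hE _ := ContinuousMonoidHom.id _
  comm _ _ _ := ⟨g, fun _ => rfl⟩

/-- `loopGraphConj g` is locally open (conjugation is onto). [cite: MochizukiSemiAnbd2006, Def 2.2(ii) p.24] -/
theorem loopGraphConj_isLocallyOpen (g : Iw p) : (loopGraphConj p g).IsLocallyOpen := by
  constructor
  · intro v
    show IsOpen (((conjHom p g).toMonoidHom.range : Subgroup (Iw p)) : Set (Iw p))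
    have : (conjHom p g).toMonoidHom.range = ⊤ :=
      MonoidHom.range_eq_top.2 fun x => ⟨g⁻¹ * x * g, by
        show g * (g⁻¹ * x * g) * g⁻¹ = x
        group⟩
    rw [this]; exact isOpen_univ
  · intro e
    show IsOpen (((ContinuousMonoidHom.id (IwU p)).toMonoidHom.range : Subgroup (IwU p)) : Set (IwU p))
    have : (ContinuousMonoidHom.id (IwU p)).toMonoidHom.range = ⊤ :=
      MonoidHom.range_eq_top.2 fun x => ⟨x, rfl⟩
    rw [this]; exact isOpen_univ

/-- Conjugation by the translation `(1, 0)` moves the torus element `(0, 1)` (to `(−p, 1)`): the two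
morphisms `loopGraphId`, `loopGraphConj (1,0)` are DIFFERENT although they have the same base and the
same edge homomorphisms. [cite: MochizukiSemiAnbd2006, Rmk 2.4.2 p.26] -/
theorem loopGraphConj_ne_id : loopGraphConj p ⟨1, 0⟩ ≠ loopGraphId p := by
  intro h
  have hV := congrArg (fun F : ProfiniteSemiGraph.Hom (loopGraph p) (loopGraph p) =>
    (F.hV PUnit.unit (⟨0, 1⟩ : Iw p)).a) h
  change ((⟨1, 0⟩ : Iw p) * ⟨0, 1⟩ * (⟨1, 0⟩ : Iw p)⁻¹).a = (⟨0, 1⟩ : Iw p).a at hV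
  rw [(Iw.conj_coords (⟨1, 0⟩ : Iw p) ⟨0, 1⟩).2] at hV
  change -((p : ℤ_[p]) * 1 * 1) + IwahoriWitness.w p 0 * 0 = (0 : ℤ_[p]) at hV
  simp only [mul_one, mul_zero, add_zero, neg_eq_zero] at hV
  exact Iw.p_ne_zero hV

/-- **The conjugation indeterminacy of Rmk. 2.4.2 is genuinely non-trivial on `𝒢₁`** (the carrier asked
for by O-Cor39-1): two DISTINCT locally open morphisms `𝒢₁ → 𝒢₁` with the same underlying morphism of
semi-graphs and the same edge homomorphisms, differing by an inner automorphism of the (slim,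
centre-free) vertex group. [cite: MochizukiSemiAnbd2006, Rmk 2.4.2 p.26] -/
theorem exists_distinct_locallyOpen_homs_same_base :
    ∃ F F' : ProfiniteSemiGraph.Hom (loopGraph p) (loopGraph p),
      F ≠ F' ∧ F.base = F'.base ∧ (∀ e, F.hE e = F'.hE e) ∧ F.IsLocallyOpen ∧ F'.IsLocallyOpen :=
  ⟨loopGraphConj p ⟨1, 0⟩, loopGraphId p, loopGraphConj_ne_id p, rfl, fun _ => rfl,
    loopGraphConj_isLocallyOpen p _, loopGraphId_isLocallyOpen p⟩

end IwahoriWitness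

end Literature.AnabelianGeometry.SemiGraphs

end
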